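import Literature.AnabelianGeometry.EtaleTheta.BiKummerThm44SubNHSatFaithful
import HarnessLib

/-!
# [FrdII] Def 2.2 at the [EtTh] hull: `(N, H)`-saturation of `def22Ctx A` does NOT depend on the action datum at objects with
# `G_A ⥲ Aut_E(A_E)` (proof-only)

S. Mochizuki, *The geometry of Frobenioids II* [MochizukiFrdII2008], Def 2.2 (i)/(ii) p.17 («the natural action by conjugation … factors
through `G_A` … `G_A ↪ Aut_E(A_E)` … an isomorphism if, for instance, `A_D` is Galois [… Aut-ample]»); S. Mochizuki, *The étale theta
function …* [MochizukiEtTh2009], Def 4.1 (iii)(a) p.87 (saturation read at Frobenius-trivial objects «as an object of C^{bs-fld}»).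

abc-iut-w6-d047 (gen 3).  The context of record `def22Ctx X tf haug A act hact H hn ho` (p460958) carries the descended `Aut_E(A_E)`-action
as a DATUM `act` with its law `hact`; two seats' faithful slots (abc-iut-w4-d044's p466882 / this seat's p467189, and the staged canonical
`NHsatCanon`) differ only in WHICH lawful action they plug in.  KERNEL STATEMENT that the choice is immaterial where print reads Def 2.2:
* `TemperedFrobenioid.def22Ctx_iso_of_hact` — for ANY two action data `act`, `act'` obeying the law `hact` at `A`, and `res : Aut_C(A) → Aut_E(A_E)`
  SURJECTIVE (e.g. `A` Frobenius-trivial Galois, `resE_surjective_of_mapAut_surjective` p461844), the identity maps form an isomorphism of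
  [FrdII] Def 2.2 contexts `def22Ctx … act hact … ⥲ def22Ctx … act' hact' …` (the only content: `τ • u = α u α⁻¹ = τ •' u` for a lift `α` of `τ`);
* `TemperedFrobenioid.isNHSaturated_def22Ctx_iff_of_hact` — hence `IsNHSaturated (def22Ctx … act …) N ↔ IsNHSaturated (def22Ctx … act' …) N`
  (abc-iut-L1-d4's `Def22Context.Iso.isNHSaturated_iff`);
* `TemperedFrobenioid.isNHSaturated_def22Ctx_iff_of_hact_of_isFrobeniusTrivial` — the same for Frobenius-trivial Galois `A` with no surjectivity
  hypothesis.
PROOF-ONLY (0 definitions).  Nothing here bears on [IUTchIII] Cor 3.12; typed ≠ proved for the laws `hact`, `hact'`.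
-/

noncomputable section

namespace Literature.AnabelianGeometry.EtaleTheta

open CategoryTheory Literature.AlgebraicGeometry.Frobenioids Literature.AnabelianGeometry.SemiGraphs
  Literature.AnabelianGeometry.SemiGraphs.GaloisObjects

namespace TemperedFrobenioid

variable {K : Type} [Field K] (X : TemperedArithmeticGroup.{0} K) {D₀ : Type} [Category.{0} D₀]
  {V : FrdIMonoidStub.{0}} {T₀ : RealifiedDivisorMonoids (D₀ := D₀) V}
  {VD : FrdICatStub.{1, 0, 0} (ConnectedPart (BTemp X.Pi))}
  (tf : TemperedFrobenioid T₀ (ConnectedPart (BTemp X.Pi)) VD) (haug : IsOpenMap X.aug) (A : tf.category)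
  (act act' : MulDistribMulAction (Aut (AE X tf haug A)) ↥(tf.units A))
  (hact : ∀ (α : Aut A) (u : ↥(tf.units A)),
    (by letI := act; exact (resE X tf haug A α) • u) = (⟨α * u.1 * α⁻¹, (tf.units_normal A).conj_mem _ u.2 α⟩ : ↥(tf.units A)))
  (hact' : ∀ (α : Aut A) (u : ↥(tf.units A)),
    (by letI := act'; exact (resE X tf haug A α) • u) = (⟨α * u.1 * α⁻¹, (tf.units_normal A).conj_mem _ u.2 α⟩ : ↥(tf.units A)))
  (H : Subgroup (Field.absoluteGaloisGroup K)) (hHn : H.Normal) (hHo : IsOpen (H : Set (Field.absoluteGaloisGroup K)))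

/-- **Two lawful action data give ISOMORPHIC Def 2.2 contexts (identity maps) once `res : Aut_C(A) ↠ Aut_E(A_E)` is surjective**: the only
non-trivial field `isoO_smul` reads `τ • u = α u α⁻¹ = τ •' u` for a lift `α` of `τ` (the law `hact` on both sides).
[cite: MochizukiFrdII2008, Def 2.2 (i) p.17] -/
theorem def22Ctx_iso_of_hact (hs : Function.Surjective (resE X tf haug A)) :
    Nonempty (PadicKummer.Def22Context.Iso (def22Ctx X tf haug A act hact H hHn hHo) (def22Ctx X tf haug A act' hact' H hHn hHo)) := by
  refine ⟨{ isoC := MulEquiv.refl _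
            isoO := MulEquiv.refl _
            isoE := MulEquiv.refl _
            isoG := ContinuousMulEquiv.refl _
            res_isoC := fun _ => rfl
            isoO_smul := fun τ u => ?_
            outer_isoG := fun _ => rfl
            map_H := ?_
            isGalois_iff := Iff.rfl }⟩
  · obtain ⟨α, rfl⟩ := hs τ
    exact (hact α u).trans (hact' α u).symm
  · change H.map (MonoidHom.id _) = H
    exact Subgroup.map_id H

/-- **`(N, H)`-saturation of `def22Ctx A` is independent of the lawful action datum** at objects with `res` surjective.
[cite: MochizukiFrdII2008, Def 2.2 (ii) p.17] -/
theorem isNHSaturated_def22Ctx_iff_of_hact (hs : Function.Surjective (resE X tf haug A)) (N : ℕ) :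
    PadicKummer.IsNHSaturated (def22Ctx X tf haug A act hact H hHn hHo) N ↔
      PadicKummer.IsNHSaturated (def22Ctx X tf haug A act' hact' H hHn hHo) N := by
  obtain ⟨e⟩ := def22Ctx_iso_of_hact X tf haug A act act' hact hact' H hHn hHo hs
  exact e.isNHSaturated_iff N

/-- **The same at a Frobenius-trivial Galois object** — where [EtTh] Def 4.1 (iii)(a) reads [FrdII] Def 2.2 (ii) — with no surjectivity
hypothesis (`res` is surjective there: principal ⇒ `Aut`-ample, p461844). [cite: MochizukiEtTh2009, Def 4.1 (iii) p.87] -/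
theorem isNHSaturated_def22Ctx_iff_of_hact_of_isFrobeniusTrivial (hft : PreFrobenioid.IsFrobeniusTrivial tf.toElem A)
    (hG : IsGaloisObj A.base.obj) (N : ℕ) :
    PadicKummer.IsNHSaturated (def22Ctx X tf haug A act hact H hHn hHo) N ↔
      PadicKummer.IsNHSaturated (def22Ctx X tf haug A act' hact' H hHn hHo) N :=
  isNHSaturated_def22Ctx_iff_of_hact X tf haug A act act' hact hact' H hHn hHo
    (resE_surjective_of_mapAut_surjective X tf haug A hG (tf.mapAut_surjective_of_isFrobeniusTrivial A hft)) N

end TemperedFrobenioid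

end Literature.AnabelianGeometry.EtaleTheta

end
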